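import Summits.Ventures.PercRepro.S1SevenSixLineParts

/-!
# PercRepro — THE SHAPE `(rank 5 on 9) ⊕ U_{2,4}` OF THE `(7, 6)` CELL (p2, gen 28; SUBCLAIM-S1 §6.10 (xvii)(o);
the `(7, 6)` capstone is `S1SevenSixSeparators`)

`M` coloop-free of rank `5` on `9` points with all pairs of rank `2` (a corank-`4` part), `N = U_{2,4}`.
`#U ≤ 6 N_M(5, 2) + 4 N_M(5, 3) + N_M(5, 4)` with `N_M(5, 4) ≤ C(9, 5) = 126` (a spanning `5`-set whose complement
has rank `4` — Theorem M at `(5, 4)` is vacuous, `Φ(5, 4) = 0`), Theorem N at `(5, 2)` and Theorem M at `(5, 3)`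
on `M`: `Φ(7, 4) · #U ≤ 5.04 f_M(3) + 14 f_M(4) + 352.8`; `#Y ≥ 11 f_M(3) + 15 f_M(4) + 5 f_M(5)` with
`f_M(3) ≥ 48` (at most `36` rank-`2` triples: the closure of a pair has `≤ 5` points), `f_M(4) ≥ 24` (the level
double count `2 f_M(3) ≤ 4 f_M(4)`), `f_M(5) ≥ 10`: margin `7.3`. Nothing is claimed about any cell.

* `ncard_profileSet_top_zero_le_of_pairs` — `N(a, 0) ≤ 1` in a loopless matroid;
* `c025_seven_four_disjointSum_rank_five_nine_line_four`.
Axioms: standard.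
-/

open scoped Matroid

namespace PercRepro

namespace S1

open Set

variable {α : Type}

/-- `N(a, 0) ≤ 1` when all pairs have rank `2` and there are at least two points: a complement of rank `0` is
empty (a point of it would be a loop, through which a pair has rank `≤ 1`). -/
theorem ncard_profileSet_top_zero_le_of_pairs (N : Matroid α) [N.Finite]
    (hpairs : ∀ e ∈ N.E, ∀ f ∈ N.E, e ≠ f → N.eRk {e, f} = 2) (h2 : 2 ≤ N.E.ncard) (a : ℕ) :
    (profileSet N a 0).ncard ≤ 1 := by
  have hsub : profileSet N a 0 ⊆ {N.E} := by
    rintro A ⟨hAE, -, hAc⟩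
    rw [mem_singleton_iff]
    refine hAE.antisymm ?_
    by_contra hne
    obtain ⟨x, hxE, hxA⟩ := Set.not_subset.mp hne
    have hx0 : N.eRk {x} = 0 := by
      have := N.eRk_mono (show ({x} : Set α) ⊆ N.E \ A from singleton_subset_iff.mpr ⟨hxE, hxA⟩)
      rw [hAc] at this
      exact le_antisymm this bot_le
    obtain ⟨y, hyE, hyx⟩ : ∃ y ∈ N.E, y ≠ x := by
      by_contra hcon
      push Not at hcon
      have : N.E ⊆ {x} := fun z hz => by rw [mem_singleton_iff]; exact hcon z hz
      have := ncard_le_ncard this (finite_singleton x)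
      rw [ncard_singleton] at this
      omega
    have h2' := hpairs x hxE y hyE (Ne.symm hyx)
    have hle : N.eRk {x, y} ≤ N.eRk {x} + N.eRk {y} := by
      rw [show ({x, y} : Set α) = {x} ∪ {y} from rfl]
      exact N.eRk_union_le_eRk_add_eRk _ _
    rw [h2', hx0, zero_add] at hle
    have := (hle.trans (N.eRk_singleton_le y))
    exact absurd this (by decide)
  exact (ncard_le_ncard hsub (finite_singleton _)).trans (by rw [ncard_singleton])

/-- The arithmetic of `(rank 5 on 9) ⊕ U_{2,4}` at `(7, 4)`. -/
theorem consumer_arith_rank_five_nine_line_four {u y P2 P3 f3 f4 f5 : ℚ} (hU : u ≤ 6 * P2 + 4 * P3 + 126)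
    (h52 : 10 / 3 * P2 ≤ f3 + f4) (h53 : 5 / 4 * P3 ≤ f4) (hY : 11 * f3 + 15 * f4 + 5 * f5 ≤ y)
    (hf3 : 48 ≤ f3) (hf4 : 24 ≤ f4) (hf5 : 10 ≤ f5) : 14 / 5 * u ≤ y := by
  linarith

/-- **`M ⊕ U_{2,4}` at `(7, 4)`**: `M` coloop-free of rank `5` on `9` points with all pairs of rank `2`, `N` of rank
`2` on `4` points with all pairs of rank `2`. -/
theorem c025_seven_four_disjointSum_rank_five_nine_line_four (M N : Matroid α) [M.Finite] [N.Finite]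
    (h : Disjoint M.E N.E) (hM : M.eRank = ((5 : ℕ) : ℕ∞)) (hME : M.E.ncard = 9) (hcolM : M.coloops = ∅)
    (hpairsM : ∀ e ∈ M.E, ∀ f ∈ M.E, e ≠ f → M.eRk {e, f} = 2) (hN : N.eRank = ((2 : ℕ) : ℕ∞))
    (hNE : N.E.ncard = 4) (hpairsN : ∀ e ∈ N.E, ∀ f ∈ N.E, e ≠ f → N.eRk {e, f} = 2) :
    phiK 7 4 * ({A : Set α | A ⊆ (M.disjointSum N h).E ∧ (M.disjointSum N h).eRk A = ((7 : ℕ) : ℕ∞) ∧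
        (M.disjointSum N h).eRk ((M.disjointSum N h).E \ A) = ((4 : ℕ) : ℕ∞)}.ncard : ℚ) ≤
      ({A : Set α | A ⊆ (M.disjointSum N h).E ∧ ((4 : ℕ) : ℕ∞) < (M.disjointSum N h).eRk A ∧
        (M.disjointSum N h).eRk A < ((7 : ℕ) : ℕ∞)}.ncard : ℚ) := by
  -- the `U`-side: the slices `(5, 2)`, `(5, 3)`, `(5, 4)`
  have hU : {A : Set α | A ⊆ (M.disjointSum N h).E ∧ (M.disjointSum N h).eRk A = ((7 : ℕ) : ℕ∞) ∧
      (M.disjointSum N h).eRk ((M.disjointSum N h).E \ A) = ((4 : ℕ) : ℕ∞)}.ncard ≤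
      6 * (profileSet M 5 2).ncard + 4 * (profileSet M 5 3).ncard + 126 := by
    rw [disjointSum_ncard_U_eq_finsum M N h 7 4, finsum_mem_coe_finset]
    have hsub : ({(5, 2), (5, 3), (5, 4)} : Finset (ℕ × ℕ)) ⊆ Finset.range (7 + 1) ×ˢ Finset.range (4 + 1) := by
      decide
    rw [← Finset.sum_subset hsub ?_]
    · rw [Finset.sum_insert (by decide), Finset.sum_insert (by decide), Finset.sum_singleton]
      dsimp only
      show (profileSet M 5 2).ncard * (profileSet N 2 2).ncard + ((profileSet M 5 3).ncard * (profileSet N 2 1).ncard +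
        (profileSet M 5 4).ncard * (profileSet N 2 0).ncard) ≤ _
      have g22 := ncard_profileSet_le_choose_of_ncard_eq (N := N) (a := 2) (b := 2) hNE
      rw [show Nat.choose (2 + 2) 2 = 6 by decide] at g22
      have g21 := ncard_profileSet_top_one_le_of_pairs' hpairsN 2
      rw [hNE] at g21
      have g20 := ncard_profileSet_top_zero_le_of_pairs N hpairsN (by omega) 2
      have h54 := ncard_profileSet_le_choose_of_ncard_eq (N := M) (a := 5) (b := 4) hME
      rw [show Nat.choose (5 + 4) 5 = 126 by decide] at h54
      have e1 := Nat.mul_le_mul_left (profileSet M 5 2).ncard g22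
      have e2 := Nat.mul_le_mul_left (profileSet M 5 3).ncard g21
      have e3 := Nat.mul_le_mul h54 g20
      nlinarith [e1, e2, e3]
    · rintro ⟨a, b⟩ hmem hnot
      rw [Finset.mem_product, Finset.mem_range, Finset.mem_range] at hmem
      simp only [Finset.mem_insert, Finset.mem_singleton, Prod.mk.injEq, not_or] at hnot
      dsimp only
      rcases Nat.lt_or_ge 5 a with ha | ha
      · rw [profileSet_eq_empty_of_eRank_lt M hM ha b, ncard_empty, zero_mul]
      rcases Nat.lt_or_ge a 5 with ha' | ha'
      · have h7a : 2 < 7 - a := by omega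
        rw [profileSet_eq_empty_of_eRank_lt N hN h7a (4 - b), ncard_empty, mul_zero]
      have ha5 : a = 5 := by omega
      subst ha5
      rw [show (7 : ℕ) - 5 = 2 from rfl]
      have hb : b < 2 := by omega
      rw [profileSet_eq_empty_of_eRank_lt_snd N hN (by omega) 2, ncard_empty, mul_zero]
  -- the `Y`-side
  have hY : 11 * (rankSet M 3).ncard + 15 * (rankSet M 4).ncard + 5 * (rankSet M 5).ncard ≤
      {A : Set α | A ⊆ (M.disjointSum N h).E ∧ ((4 : ℕ) : ℕ∞) < (M.disjointSum N h).eRk A ∧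
        (M.disjointSum N h).eRk A < ((7 : ℕ) : ℕ∞)}.ncard := by
    rw [disjointSum_ncard_Y_eq_finsum M N h 7 4, finsum_mem_coe_finset]
    have hsub : ({(3, 2), (4, 1), (4, 2), (5, 0), (5, 1)} : Finset (ℕ × ℕ)) ⊆
        (Finset.range 7 ×ˢ Finset.range 7).filter (fun x : ℕ × ℕ => 4 < x.1 + x.2 ∧ x.1 + x.2 < 7) := by
      decide
    refine le_trans ?_ (Finset.sum_le_sum_of_subset hsub)
    rw [Finset.sum_insert (by decide), Finset.sum_insert (by decide), Finset.sum_insert (by decide),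
      Finset.sum_insert (by decide), Finset.sum_singleton]
    dsimp only
    have f0 : 1 ≤ (rankSet N 0).ncard := by
      have h0 : (∅ : Set α) ∈ rankSet N 0 := ⟨empty_subset _, by rw [N.eRk_empty]; rfl⟩
      exact (ncard_pos (rankSet_finite N 0)).mpr ⟨∅, h0⟩
    have f1 : 4 ≤ (rankSet N 1).ncard := by
      have := ncard_le_ncard_rankSet_one_of_pairs hpairsN (by omega)
      rwa [hNE] at this
    have f2 : 11 ≤ (rankSet N 2).ncard := by
      have := ncard_rankSet_two_ge_of_rank_two N hN hpairsN
      rwa [hNE, show 2 ^ 4 - 1 - 4 = 11 by decide] at this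
    have e32 := Nat.mul_le_mul_left (rankSet M 3).ncard f2
    have e41 := Nat.mul_le_mul_left (rankSet M 4).ncard f1
    have e42 := Nat.mul_le_mul_left (rankSet M 4).ncard f2
    have e50 := Nat.mul_le_mul_left (rankSet M 5).ncard f0
    have e51 := Nat.mul_le_mul_left (rankSet M 5).ncard f1
    linarith
  -- the profile of `M`
  have hcl : ∀ x ∈ M.E, ∀ y ∈ M.E, x ≠ y → (M.closure {x, y}).ncard ≤ 3 + 2 := by
    intro x hx y hy hxy
    have := ncard_closure_pair_le_of_coloops' M hM (by norm_num) hcolM hpairsM hx hy hxy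
    rw [hME] at this
    omega
  have ht := three_mul_ncard_rankTwoTriples_le_of_closure M hpairsM hcl
  rw [hME, show Nat.choose 9 2 = 36 by decide] at ht
  have hf3 : 48 ≤ (rankSet M 3).ncard := by
    have h := choose_sub_ncard_rankTwoTriples_le_ncard_rankSet_three M hpairsM
    rw [hME, show Nat.choose 9 3 = 84 by decide] at h
    omega
  have hf4 : 24 ≤ (rankSet M 4).ncard := by
    have hdc : (5 - 3) * (rankSet M 3).ncard ≤ (3 + 1) * (rankSet M (3 + 1)).ncard :=
      sub_mul_ncard_rankSet_le M hM 3
    have hdc' : 2 * (rankSet M 3).ncard ≤ 4 * (rankSet M 4).ncard := hdc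
    omega
  have hf5 : 10 ≤ (rankSet M 5).ncard := by
    have := succ_le_ncard_rankSet_top_of_coloops M hM hcolM
    rwa [hME] at this
  -- the tree cells on `M`
  have h52 : (10 / 3 : ℚ) * ((profileSet M 5 2).ncard : ℚ) ≤
      ((rankSet M 3).ncard : ℚ) + ((rankSet M 4).ncard : ℚ) := by
    have h0 := ThmN.c025_two_all M 5 (by norm_num)
    unfold ThmN.RLS at h0
    rw [phiK_five_two, ySet_eq_rankSet_union_of_eq M (q := 2) (p := 5) (k := 3) (k' := 4) rfl rfl rfl,
      ncard_union_eq (rankSet_disjoint_of_ne M (by norm_num)) (rankSet_finite M 3) (rankSet_finite M 4)] at h0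
    push_cast at h0
    exact h0
  have h53 : (5 / 4 : ℚ) * ((profileSet M 5 3).ncard : ℚ) ≤ ((rankSet M 4).ncard : ℚ) := by
    have h0 := SevenThree.c025_three_all M 5 (by norm_num)
    unfold ThmN.RLS at h0
    rw [ThmO.phiK_five_three, ySet_eq_rankSet_of_eq M (q := 3) (p := 5) (k := 4) rfl rfl] at h0
    exact h0
  rw [phiK_seven_four]
  have hU' : (({A : Set α | A ⊆ (M.disjointSum N h).E ∧ (M.disjointSum N h).eRk A = ((7 : ℕ) : ℕ∞) ∧
      (M.disjointSum N h).eRk ((M.disjointSum N h).E \ A) = ((4 : ℕ) : ℕ∞)}.ncard : ℕ) : ℚ) ≤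
      6 * ((profileSet M 5 2).ncard : ℚ) + 4 * ((profileSet M 5 3).ncard : ℚ) + 126 := by
    exact_mod_cast hU
  have hY' : 11 * ((rankSet M 3).ncard : ℚ) + 15 * ((rankSet M 4).ncard : ℚ) + 5 * ((rankSet M 5).ncard : ℚ) ≤
      (({A : Set α | A ⊆ (M.disjointSum N h).E ∧ ((4 : ℕ) : ℕ∞) < (M.disjointSum N h).eRk A ∧
        (M.disjointSum N h).eRk A < ((7 : ℕ) : ℕ∞)}.ncard : ℕ) : ℚ) := by
    exact_mod_cast hY
  have hf3' : (48 : ℚ) ≤ ((rankSet M 3).ncard : ℚ) := by exact_mod_cast hf3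
  have hf4' : (24 : ℚ) ≤ ((rankSet M 4).ncard : ℚ) := by exact_mod_cast hf4
  have hf5' : (10 : ℚ) ≤ ((rankSet M 5).ncard : ℚ) := by exact_mod_cast hf5
  exact consumer_arith_rank_five_nine_line_four hU' h52 h53 hY' hf3' hf4' hf5'

end S1

end PercRepro
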